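import Summits.MatrixMultiplication.OmegaCensus.MetaCyclic
import Summits.MatrixMultiplication.OmegaCensus.MetacyclicTowerAll
import Summits.MatrixMultiplication.OmegaCensus.BoxUsefulSections
import Summits.MatrixMultiplication.OmegaCensus.BoxUsefulFactors

/-!
# ω-census, family (b3): conjecture C9 — every Rédei metacyclic group `M_p(m,n) = ℤ/p^m ⋊ ℤ/p^n` (odd `p`) is not box-useful, on the census type `MetaCyc`

HONEST FRAMING (pub-omega census; verbatim): lottery ticket; floor = certified bounds/negative ranges.
Census BOOKKEEPING (conjecture C9 of the cell; pub-omega kernel-l4 gen 14, task K-1′ of RULING L28-11, built on stpp-1 gen 19's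
metacyclic tower).  Rédei's metacyclic minimal non-abelian `p`-groups are
`M_p(m,n) = ⟨a, b | a^{p^m} = b^{p^n} = 1, b a b⁻¹ = a^{1+p^{m-1}}⟩` (`m ≥ 2`, `n ≥ 1`); on the census's kernel-computable split
metacyclic type (`MetaCyclic.lean`) this is LITERALLY `MetaCyc (p^m) (p^n) (1 + p^{m-1})` (`u = 1 + Mmeta.Q p m`, `Mmeta.Q p m = p^{m-1}`
in `ℤ/p^m`).  This file proves, with no new box computation:
* `u^k = 1 + k p^{m-1}` (`uM_pow`, binomial theorem with `(p^{m-1})² = 0`), `u^p = 1` (`uM_pow_p`) and the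
  `Fact` instances making `MetaCyc (p^m) p u` and `MetaCyc (p^m) (p^n) u` groups (`fact_uM_pow_p`, `fact_uM_pow_pow`);
* `toMmeta : MetaCyc (p^m) p u ≃* Mmeta p m` — stpp-1's model `Mmeta p m` of `M_p(m,1)` (`MetacyclicTower.lean`) IS the census type
  (coordinate swap; `u^t = 1 + p^{m-1} t̂`), so `not_boxUseful_metaCyc_pm`: `¬ BoxUseful (MetaCyc (p^m) p u)` for odd `p ≥ 3`, `m ≥ 2`
  (`Mcube.not_boxUseful_mmeta`);
* `redB : MetaCyc N (p^n) u →* MetaCyc N p u`, `a^i b^t ↦ a^i b^{t mod p}` (a homomorphism because `u^p = 1`; surjective) — the quotient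
  `M_p(m,n) ↠ M_p(m,1)` by the central subgroup `⟨b^p⟩`;
* **`not_boxUseful_redeiM`: `¬ BoxUseful (MetaCyc (p^m) (p^n) (1 + Mmeta.Q p m))` for every odd `p ≥ 3`, `m ≥ 2`, `n ≥ 1`** — ALL Rédei
  metacyclic minimal non-abelian `p`-groups of odd order are box-useless in the kernel (C9 (a) lift `BoxUseful.of_surjective`) — with the
  surjective / injective lifts `not_boxUseful_of_surjective_redeiM`, `not_boxUseful_of_injective_redeiM` (and the general
  `BoxUseful.of_injective`, the embedding form of `BoxUseful.subgroup`);
* the `p³` member in the spelling of the cell's ruling L28-11: `toMcube : MetaCyc (p^2) p (1 + p) ≃* Mcube p` and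
  **`not_boxUseful_metaCyc_p2 : Odd p → 3 ≤ p → ¬ BoxUseful (MetaCyc (p^2) p (1 + p))`**.
Together with `BoxBadRedeiN` (`N_p(m,n) ↠ He_p`) every group on Rédei's 1947 list of minimal non-abelian `p`-groups of ODD order is now
box-useless in the kernel; the classification itself is not formalised here.  Nothing here is progress on `ω`.
-/

namespace Summit.MatrixMultiplication.OmegaCensus

open Finset ProductBoxBound

section Injective

variable {G : Type*} [Group G] [Fintype G] [DecidableEq G]

/-- **Box-usefulness passes along embeddings to the source** (C9 (a), subgroup half, homomorphism form): if `f : Q →* G` is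
injective and `G` is box-useful then so is `Q` (`BoxUseful.subgroup` on `f.range ≃* Q`). [folklore] -/
theorem BoxUseful.of_injective {Q : Type*} [Group Q] [Fintype Q] [DecidableEq Q] (f : Q →* G)
    (hf : Function.Injective f) (hG : BoxUseful G) : BoxUseful Q := by
  classical
  haveI : Fintype ↥f.range := Fintype.ofFinite _
  have hH : BoxUseful ↥f.range := hG.subgroup f.range
  exact BoxUseful.of_surjective (MonoidHom.ofInjective hf).symm.toMonoidHom (MonoidHom.ofInjective hf).symm.surjective hH

end Injective

namespace MetaCyc

variable {p m n : ℕ}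

/-! ### The Rédei unit `u = 1 + p^{m-1}` of `ℤ/p^m` -/

/-- `u^k = 1 + k·p^{m-1}` for the Rédei unit `u = 1 + p^{m-1}` of `ℤ/p^m` (`m ≥ 2`; binomial theorem with `(p^{m-1})² = 0` —
the general ring lemma is the tree's `Literature.NumberTheory.Sieve.MontgomeryVaughan1975.one_add_pow_of_mul_self_eq_zero`, not
imported here to keep this census file free of analytic number theory). [folklore] -/
theorem uM_pow [Fact (2 ≤ m)] (k : ℕ) : (1 + Mmeta.Q p m) ^ k = 1 + (k : ZMod (p ^ m)) * Mmeta.Q p m := by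
  induction k with
  | zero => simp
  | succ k ih =>
    rw [pow_succ, ih, Nat.cast_succ]
    linear_combination (k : ZMod (p ^ m)) * Mmeta.QQ_eq_zero (p := p) (m := m)

/-- `u^p = 1` for the Rédei unit (`p·p^{m-1} = 0` in `ℤ/p^m`). [folklore] -/
theorem uM_pow_p [Fact (2 ≤ m)] : (1 + Mmeta.Q p m) ^ p = 1 := by
  rw [uM_pow, mul_comm, Mmeta.Q_mul_p, add_zero]

/-- `u^p = 1`: `MetaCyc (p^m) p (1 + p^{m-1}) = M_p(m,1)` is a group. [folklore] -/
instance fact_uM_pow_p [Fact (2 ≤ m)] : Fact ((1 + Mmeta.Q p m) ^ p = 1) := ⟨uM_pow_p⟩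

/-- `u^{p^n} = 1` (`n ≥ 1`): `MetaCyc (p^m) (p^n) (1 + p^{m-1}) = M_p(m,n)` is a group. [folklore] -/
instance fact_uM_pow_pow [Fact (2 ≤ m)] [NeZero n] : Fact ((1 + Mmeta.Q p m) ^ (p ^ n) = 1) :=
  ⟨by
    obtain ⟨k, hk⟩ := Nat.exists_eq_succ_of_ne_zero (NeZero.ne n)
    rw [hk, pow_succ', pow_mul, uM_pow_p, one_pow]⟩

/-- `b^t` acts on `⟨a⟩ = ℤ/p^m` as multiplication by `1 + p^{m-1}·t̂`. [folklore] -/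
theorem act_uM [Fact (2 ≤ m)] (t : ZMod p) : act (1 + Mmeta.Q p m) t = 1 + Mmeta.Q p m * Mmeta.L m t := by
  unfold act Mmeta.L
  rw [uM_pow, mul_comm]

/-! ### `M_p(m,1)`: the census type is stpp-1's model `Mmeta p m` -/

/-- **The model isomorphism `MetaCyc (p^m) p (1 + p^{m-1}) ≃* Mmeta p m`**, `a^i b^t ↦ (t, i)` (coordinate swap). [folklore] -/
def toMmeta [NeZero p] [Fact (2 ≤ m)] : MetaCyc (p ^ m) p (1 + Mmeta.Q p m) ≃* Mmeta p m where
  toFun x := ⟨x.t, x.i⟩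
  invFun g := ⟨g.x, g.t⟩
  left_inv _ := rfl
  right_inv _ := rfl
  map_mul' x y := by
    apply Mmeta.ext
    · rfl
    · show (x * y).i = x.i + y.i + Mmeta.Q p m * Mmeta.L m x.t * y.i
      rw [mul_def, act_uM]
      ring

/-- **`M_p(m,1) = MetaCyc (p^m) p (1 + p^{m-1})` is not box-useful** for every odd `p ≥ 3` and `m ≥ 2` (stpp-1's
`Mcube.not_boxUseful_mmeta` transported along `toMmeta`). [folklore] -/
theorem not_boxUseful_metaCyc_pm [NeZero p] [Fact (2 ≤ m)] (hp : Odd p) (h3 : 3 ≤ p) :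
    ¬ BoxUseful (MetaCyc (p ^ m) p (1 + Mmeta.Q p m)) := fun h =>
  Mcube.not_boxUseful_mmeta hp h3
    (BoxUseful.of_surjective (toMmeta (p := p) (m := m)).toMonoidHom
      (fun g => ⟨(toMmeta (p := p) (m := m)).symm g, MulEquiv.apply_symm_apply _ g⟩) h)

/-! ### `M_p(m,n) ↠ M_p(m,1)`: reducing the `b`-exponent modulo `p` -/

section Reduce

variable {N : ℕ} {u : ZMod N}

/-- When `u^p = 1`, the action `u^t` of `t ∈ ℤ/p^n` only depends on `t mod p`. [folklore] -/
theorem act_eq_act_cast [NeZero p] [NeZero n] (hu : u ^ p = 1) (t : ZMod (p ^ n)) :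
    act u t = act u (ZMod.castHom (dvd_pow_self p (NeZero.ne n)) (ZMod p) t) := by
  unfold act
  rw [ZMod.castHom_apply, ZMod.cast_eq_val, ZMod.val_natCast]
  conv_lhs => rw [← Nat.mod_add_div t.val p, pow_add, pow_mul, hu, one_pow, mul_one]

/-- **The reduction `MetaCyc N (p^n) u →* MetaCyc N p u`**, `a^i b^t ↦ a^i b^{t mod p}` (`u^p = 1`): for `N = p^m`,
`u = 1 + p^{m-1}` this is Rédei's quotient map `M_p(m,n) ↠ M_p(m,1)` by the central subgroup `⟨b^p⟩`. [folklore] -/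
def redB [NeZero p] [NeZero n] [Fact (u ^ p = 1)] [Fact (u ^ (p ^ n) = 1)] :
    MetaCyc N (p ^ n) u →* MetaCyc N p u where
  toFun x := ⟨x.i, ZMod.castHom (dvd_pow_self p (NeZero.ne n)) (ZMod p) x.t⟩
  map_one' := by
    apply ext
    · rfl
    · simp only [one_def, map_zero]
  map_mul' x y := by
    apply ext
    · simp only [mul_def]
      rw [act_eq_act_cast (n := n) Fact.out]
    · simp only [mul_def, map_add]

/-- `redB` is surjective (`b^s ↦ b^s`). [folklore] -/
theorem redB_surjective [NeZero p] [NeZero n] [Fact (u ^ p = 1)] [Fact (u ^ (p ^ n) = 1)] :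
    Function.Surjective (redB (p := p) (n := n) (N := N) (u := u)) := by
  intro y
  refine ⟨⟨y.i, ((y.t.val : ℕ) : ZMod (p ^ n))⟩, ?_⟩
  apply ext
  · rfl
  · show ZMod.castHom _ (ZMod p) ((y.t.val : ℕ) : ZMod (p ^ n)) = y.t
    rw [map_natCast, ZMod.natCast_zmod_val]

end Reduce

/-! ### All of Rédei's `M_p(m,n)`, odd `p` -/

/-- **MAIN.  Every Rédei metacyclic group `M_p(m,n) = MetaCyc (p^m) (p^n) (1 + p^{m-1})` with `p ≥ 3` odd, `m ≥ 2`, `n ≥ 1` is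
NOT box-useful** (`M_p(m,n) ↠ M_p(m,1)`, C9 (a)). [folklore] -/
theorem not_boxUseful_redeiM [NeZero p] [Fact (2 ≤ m)] [NeZero n] (hp : Odd p) (h3 : 3 ≤ p) :
    ¬ BoxUseful (MetaCyc (p ^ m) (p ^ n) (1 + Mmeta.Q p m)) := fun h =>
  not_boxUseful_metaCyc_pm hp h3 (BoxUseful.of_surjective redB redB_surjective h)

/-- No finite group mapping onto some `M_p(m,n)` (`p ≥ 3` odd, `m ≥ 2`, `n ≥ 1`) is box-useful. [folklore] -/
theorem not_boxUseful_of_surjective_redeiM [NeZero p] [Fact (2 ≤ m)] [NeZero n] (hp : Odd p) (h3 : 3 ≤ p)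
    {G : Type*} [Group G] [Fintype G] [DecidableEq G] (f : G →* MetaCyc (p ^ m) (p ^ n) (1 + Mmeta.Q p m))
    (hf : Function.Surjective f) : ¬ BoxUseful G := fun hG =>
  not_boxUseful_redeiM hp h3 (BoxUseful.of_surjective f hf hG)

/-- No finite group containing some `M_p(m,n)` (`p ≥ 3` odd, `m ≥ 2`, `n ≥ 1`) is box-useful. [folklore] -/
theorem not_boxUseful_of_injective_redeiM [NeZero p] [Fact (2 ≤ m)] [NeZero n] (hp : Odd p) (h3 : 3 ≤ p)
    {G : Type*} [Group G] [Fintype G] [DecidableEq G] (f : MetaCyc (p ^ m) (p ^ n) (1 + Mmeta.Q p m) →* G)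
    (hf : Function.Injective f) : ¬ BoxUseful G := fun hG =>
  not_boxUseful_redeiM hp h3 (BoxUseful.of_injective f hf hG)

/-! ### The `p³` member in the spelling `MetaCyc (p^2) p (1 + p)` -/

/-- `(1+p)^k = 1 + k·p` in `ℤ/p²`. [folklore] -/
theorem one_add_p_pow (p k : ℕ) : (1 + (p : ZMod (p ^ 2))) ^ k = 1 + (k : ZMod (p ^ 2)) * p := by
  induction k with
  | zero => simp
  | succ k ih =>
    rw [pow_succ (1 + (p : ZMod (p ^ 2))) k, ih, Nat.cast_succ]
    linear_combination (k : ZMod (p ^ 2)) * Mcube.pp_eq_zero (p := p)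

/-- `(1+p)^p = 1` in `ℤ/p²`: `MetaCyc (p^2) p (1 + p) = M(p³)` is a group. [folklore] -/
instance fact_one_add_p_pow (p : ℕ) : Fact ((1 + (p : ZMod (p ^ 2))) ^ p = 1) :=
  ⟨by rw [one_add_p_pow, Mcube.pp_eq_zero, add_zero]⟩

/-- `b^t` acts on `⟨a⟩ = ℤ/p²` as multiplication by `1 + p·t̂`. [folklore] -/
theorem act_one_add_p (t : ZMod p) : act (1 + (p : ZMod (p ^ 2))) t = 1 + (p : ZMod (p ^ 2)) * Mcube.L t := by
  unfold act Mcube.L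
  rw [one_add_p_pow, mul_comm]

/-- **The model isomorphism `MetaCyc (p^2) p (1 + p) ≃* Mcube p`** (stpp-1's model of `M(p³)`), `a^i b^t ↦ (t, i)`. [folklore] -/
def toMcube [NeZero p] : MetaCyc (p ^ 2) p (1 + (p : ZMod (p ^ 2))) ≃* Mcube p where
  toFun x := ⟨x.t, x.i⟩
  invFun g := ⟨g.x, g.t⟩
  left_inv _ := rfl
  right_inv _ := rfl
  map_mul' x y := by
    apply Mcube.ext
    · rfl
    · show (x * y).i = x.i + y.i + (p : ZMod (p ^ 2)) * Mcube.L x.t * y.i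
      rw [mul_def, act_one_add_p]
      ring

/-- **`M(p³) = MetaCyc (p^2) p (1 + p)` is not box-useful for every odd `p ≥ 3`** — the headline of the cell's ruling L28-11 on the
census type, from stpp-1's `Mcube.not_boxUseful_mcube_odd` along `toMcube`. [folklore] -/
theorem not_boxUseful_metaCyc_p2 [NeZero p] (hp : Odd p) (h3 : 3 ≤ p) :
    ¬ BoxUseful (MetaCyc (p ^ 2) p (1 + (p : ZMod (p ^ 2)))) := fun h =>
  Mcube.not_boxUseful_mcube_odd hp h3
    (BoxUseful.of_surjective (toMcube (p := p)).toMonoidHom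
      (fun g => ⟨(toMcube (p := p)).symm g, MulEquiv.apply_symm_apply _ g⟩) h)

/-- No finite group mapping onto `M(p³) = MetaCyc (p^2) p (1 + p)` (`p ≥ 3` odd) is box-useful. [folklore] -/
theorem not_boxUseful_of_surjective_metaCyc_p2 [NeZero p] (hp : Odd p) (h3 : 3 ≤ p)
    {G : Type*} [Group G] [Fintype G] [DecidableEq G] (f : G →* MetaCyc (p ^ 2) p (1 + (p : ZMod (p ^ 2))))
    (hf : Function.Surjective f) : ¬ BoxUseful G := fun hG =>
  not_boxUseful_metaCyc_p2 hp h3 (BoxUseful.of_surjective f hf hG)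

/-- No finite group containing `M(p³) = MetaCyc (p^2) p (1 + p)` (`p ≥ 3` odd) is box-useful. [folklore] -/
theorem not_boxUseful_of_injective_metaCyc_p2 [NeZero p] (hp : Odd p) (h3 : 3 ≤ p)
    {G : Type*} [Group G] [Fintype G] [DecidableEq G] (f : MetaCyc (p ^ 2) p (1 + (p : ZMod (p ^ 2))) →* G)
    (hf : Function.Injective f) : ¬ BoxUseful G := fun hG =>
  not_boxUseful_metaCyc_p2 hp h3 (BoxUseful.of_injective f hf hG)

end MetaCyc

end Summit.MatrixMultiplication.OmegaCensus
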